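import Mathlib.RingTheory.LocalRing.MaximalIdeal.Basic
import Mathlib.Algebra.Module.LinearMap.Defs
import Mathlib.Algebra.Group.Subgroup.Basic
import HarnessLib

/-!
# Transport of an eigenLINE decomposition along an evaluation map (the module-theoretic core of «complex
# conjugation splits `H¹_f(K_ℓ, T̄)` and `H¹_s(K_ℓ, T̄)` into one-dimensional eigenspaces», Howard 2004, Lemma 1.5.3)

Topic `Algebra/Module` (pure algebra; Mathlib-only imports). THEOREMS ONLY: no definition, no named fact, no instance,
no notation, no `sorry`. Cell `pub/bsd-print-x9`, print leaf G87 `Howard2004.thm161_dvrKolyvaginBound`; seat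
`bsd-line-x10b-p1-w5` g8, the core of (EIG-LINES) — consumed by `NumberTheory/GaloisCohomology/Howard2004/InertEigenlinesProofs`.

SOURCE. B. Howard, *The Heegner point Kolyvagin system*, Compositio Math. **140** (2004) = arXiv:1202.6340, proof of
Lemma 1.5.3 (p. 10 L12–16): «the action of complex conjugation splits `H¹_f(K_ℓ, T̄)` and `H¹_s(K_ℓ, T̄)` each into
one-dimensional eigenspaces by H.5 and the isomorphisms `H¹_f(K_ℓ, T̄) ≅ T̄ ≅ H¹_s(K_ℓ, T̄) ⊗ k^×` of Proposition 1.1.7».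
Abstractly: an additive `ev : V → N` which is injective on a subgroup `L ≤ V`, maps `L` onto `N`, is compatible with a
family of scalar operators, and intertwines an additive `τ` on `L` with `s • Θ` (`s = ±1`) for an `R`-linear `Θ` on
`N`; if `Θ` splits `N` into an H.5(a)-shaped pair of eigenvectors (`N = R xp + R xm`, `Θ xp = xp`, `Θ xm = −xm`,
both non-zero) over a LOCAL ring `R` whose maximal ideal kills `N` (so `N` is a vector space over the residue field)
and `N` has no `2`-torsion, then the eigen-structure transports to `L`.

WHAT IS PROVED.
* (private `isUnit_of_smul_ne_zero`: a scalar acting non-trivially on a module killed by `𝔪` is a unit),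
  `eq_smul_of_eigen` (coordinates of a `Θ`-eigenvector in an H.5(a)-shaped pair);
* **`eigen_decomposition_and_line_of_eval`**: (i) every `b ∈ L` is `b₁ + b₂` with `b₁, b₂ ∈ L`, `τ b₁ = b₁`,
  `τ b₂ = −b₂`; (ii) for `ε = ±1` every `ε`-eigenvector of `τ` in `L` is `smulV r v` for any fixed non-zero
  `ε`-eigenvector `v ∈ L` — the `ε`-eigenpart of `L` is a LINE (the letter shapes `hdecT` / `hline` of
  `Howard2004/EigenSelmerDichotomyProofs.map_inf_le_or_le_of_isotropic_of_eigen`).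

No summit statement is proved; BSD is not proved by any of this.
References: [Howard2004HeegnerKolyvagin] Lemma 1.5.3, Prop. 1.1.7, H.5(a).
-/

set_option autoImplicit false

namespace Literature.Algebra.Module

section EigenlineTransport

variable {V N : Type*} [AddCommGroup V] [AddCommGroup N] {R : Type*} [CommRing R] [IsLocalRing R]
  [Module R N]

/-- In a module killed by the maximal ideal of a local ring, a scalar acting non-trivially on some vector is a
unit. [folklore] -/
private theorem isUnit_of_smul_ne_zero (hm : ∀ a ∈ IsLocalRing.maximalIdeal R, ∀ x : N, a • x = 0)
    {a : R} {x : N} (h : a • x ≠ 0) : IsUnit a := by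
  by_contra ha
  exact h (hm a ((IsLocalRing.mem_maximalIdeal a).mpr ha) x)

omit [IsLocalRing R] in
/-- **Eigen-coordinates for an `H.5(a)`-shaped pair.** If `Θ xp = xp`, `Θ xm = -xm` and `w = a • xp + b • xm` with
`Θ w = w` (resp. `Θ w = -w`), then `w = a • xp` (resp. `w = b • xm`), provided `N` has no `2`-torsion.
[cite: Howard2004HeegnerKolyvagin, §1.3 H.5(a) (arXiv:1202.6340 p. 7 L93–95: «one-dimensional eigenspaces»)] -/
theorem eq_smul_of_eigen (Θ : N →ₗ[R] N) (h2 : ∀ x : N, 2 • x = 0 → x = 0) {xp xm : N} (hxp : Θ xp = xp)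
    (hxm : Θ xm = -xm) {w : N} {a b : R} (hw : w = a • xp + b • xm) :
    (Θ w = w → w = a • xp) ∧ (Θ w = -w → w = b • xm) := by
  subst hw
  have hΘ : Θ (a • xp + b • xm) = a • xp - b • xm := by
    rw [map_add, map_smul, map_smul, hxp, hxm, smul_neg, sub_eq_add_neg]
  constructor
  · intro h
    rw [hΘ] at h
    -- `a xp - b xm = a xp + b xm ⇒ 2 (b xm) = 0`
    have h0 : 2 • (b • xm) = 0 := by
      rw [two_nsmul]
      have := sub_eq_iff_eq_add.mp h
      -- this : a • xp = a • xp + b • xm + b • xm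
      have h1 : b • xm + b • xm = 0 := by
        have := congrArg (fun z => z - a • xp) this
        simpa [add_assoc] using this.symm
      exact h1
    rw [h2 _ h0, add_zero]
  · intro h
    rw [hΘ] at h
    -- `a xp - b xm = -(a xp + b xm) ⇒ 2 (a xp) = 0`
    have h0 : 2 • (a • xp) = 0 := by
      rw [two_nsmul]
      have h1 : a • xp - b • xm + (a • xp + b • xm) = 0 := by rw [h, neg_add_cancel]
      have h2' : a • xp - b • xm + (a • xp + b • xm) = a • xp + a • xp := by abel
      rwa [h2'] at h1
    rw [h2 _ h0, zero_add]

/-- **Transport of the eigenline structure along an evaluation map.** Let `L ≤ V` be a subgroup, stable under an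
additive `τ` and under the scalar operators `smulV r`; `ev : V →+ N` injective on `L`, mapping `L` onto `N`, compatible
with scalars, and intertwining `τ` with `s • Θ` (`s = ±1`) for an `R`-linear `Θ` on `N` which splits `N` into an
`H.5(a)`-shaped pair of eigenvectors (`N = R xp + R xm`, `Θ xp = xp ≠ 0`, `Θ xm = -xm ≠ 0`); `R` local with maximal
ideal killing `N`, `N` without `2`-torsion. Then (i) every `b ∈ L` is `b₁ + b₂` with `b₁, b₂ ∈ L`, `τ b₁ = b₁`,
`τ b₂ = -b₂`; (ii) for `ε = ±1`, every `ε`-eigenvector of `τ` in `L` is a scalar multiple `smulV r v` of any fixed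
non-zero one — the `ε`-eigenpart of `L` is a LINE. (Howard, Lemma 1.5.3: «the action of complex conjugation splits
`H¹_f(K_ℓ, T̄)` and `H¹_s(K_ℓ, T̄)` each into one-dimensional eigenspaces by H.5 and the isomorphisms
`H¹_f(K_ℓ, T̄) ≅ T̄ ≅ H¹_s(K_ℓ, T̄) ⊗ k^×` of Proposition 1.1.7».)
[cite: Howard2004HeegnerKolyvagin, Lemma 1.5.3 proof (arXiv:1202.6340 p. 10 L12–16) with H.5(a) (p. 7 L93–95) and Prop. 1.1.7 (p. 5 L129–141)] -/
theorem eigen_decomposition_and_line_of_eval (smulV : R → V →+ V) (L : AddSubgroup V)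
    (hL : ∀ (r : R), ∀ x ∈ L, smulV r x ∈ L) (τ : V →+ V) (hτL : ∀ x ∈ L, τ x ∈ L)
    (ev : V →+ N) (hinj : ∀ x ∈ L, ev x = 0 → x = 0) (hsurj : ∀ t : N, ∃ x ∈ L, ev x = t)
    (hev_smul : ∀ (r : R) (x : V), ev (smulV r x) = r • ev x)
    (Θ : N →ₗ[R] N) {s : ℤ} (hs : s = 1 ∨ s = -1) (hτev : ∀ x ∈ L, ev (τ x) = s • Θ (ev x))
    (hΘ : ∃ xp : N, xp ≠ 0 ∧ Θ xp = xp ∧ ∃ xm : N, xm ≠ 0 ∧ Θ xm = -xm ∧ ∀ x : N, ∃ a b : R, x = a • xp + b • xm)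
    (hm : ∀ a ∈ IsLocalRing.maximalIdeal R, ∀ x : N, a • x = 0) (h2 : ∀ x : N, 2 • x = 0 → x = 0) :
    (∀ b ∈ L, ∃ b₁ ∈ L, ∃ b₂ ∈ L, τ b₁ = b₁ ∧ τ b₂ = -b₂ ∧ b = b₁ + b₂) ∧
      (∀ ε : ℤ, ε = 1 ∨ ε = -1 → ∀ v ∈ L, τ v = ε • v → v ≠ 0 →
        ∀ b ∈ L, τ b = ε • b → ∃ r : R, b = smulV r v) := by
  obtain ⟨xp, hxp0, hxp, xm, hxm0, hxm, hspan⟩ := hΘ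
  -- `ev` detects `τ`-eigenvectors in `L`: `τ x = ε • x ↔ Θ (ev x) = (s ε) • ev x`-style transfer
  have hdet : ∀ x ∈ L, ∀ y ∈ L, ev x = ev y → x = y := fun x hx y hy h =>
    sub_eq_zero.mp (hinj _ (L.sub_mem hx hy) (by rw [map_sub, h, sub_self]))
  have hs2 : s * s = 1 := by rcases hs with rfl | rfl <;> norm_num
  -- a `Θ`-eigenvector `t` with eigenvalue `s • η` lifts to a `τ`-eigenvector with eigenvalue `η` in `L`
  have hlift : ∀ (η : ℤ) (t : N), Θ t = (s * η) • t → ∃ x ∈ L, ev x = t ∧ τ x = η • x := by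
    intro η t ht
    obtain ⟨x, hxL, hx⟩ := hsurj t
    refine ⟨x, hxL, hx, hdet _ (hτL x hxL) _ (L.zsmul_mem hxL η) ?_⟩
    rw [hτev x hxL, hx, ht, map_zsmul, hx, smul_smul, ← mul_assoc, hs2, one_mul]
  refine ⟨fun b hb => ?_, fun ε hε v hv hτv hv0 b hb hτb => ?_⟩
  · -- (i) decomposition
    obtain ⟨a, c, habc⟩ := hspan (ev b)
    -- the `Θ`-eigenvectors `a xp` (value `1`) and `c xm` (value `-1`) have `τ`-eigenvalues `s` and `-s`
    have h1 : Θ (a • xp) = (s * s) • (a • xp) := by rw [hs2, one_zsmul, map_smul, hxp]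
    have h2' : Θ (c • xm) = (s * -s) • (c • xm) := by
      rw [show s * -s = -1 by rw [mul_neg, hs2], neg_one_zsmul, map_smul, hxm, smul_neg]
    obtain ⟨x₁, hx₁L, hx₁, hτ₁⟩ := hlift s (a • xp) h1
    obtain ⟨x₂, hx₂L, hx₂, hτ₂⟩ := hlift (-s) (c • xm) h2'
    have hsum : b = x₁ + x₂ := hdet _ hb _ (L.add_mem hx₁L hx₂L) (by rw [map_add, hx₁, hx₂, habc])
    rcases hs with rfl | rfl
    · rw [one_zsmul] at hτ₁
      rw [neg_one_zsmul] at hτ₂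
      exact ⟨x₁, hx₁L, x₂, hx₂L, hτ₁, hτ₂, hsum⟩
    · rw [neg_neg, one_zsmul] at hτ₂
      rw [neg_one_zsmul] at hτ₁
      exact ⟨x₂, hx₂L, x₁, hx₁L, hτ₂, hτ₁, by rw [hsum, add_comm]⟩
  · -- (ii) the `ε`-eigenpart of `L` is a line
    -- `Θ (ev y) = (s ε) • ev y` for every `ε`-eigenvector `y ∈ L`
    have hΘev : ∀ y ∈ L, τ y = ε • y → Θ (ev y) = (s * ε) • ev y := by
      intro y hyL hτy
      have h := hτev y hyL
      rw [hτy, map_zsmul] at h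
      -- `ε • ev y = s • Θ (ev y)` ⇒ `Θ (ev y) = s ε • ev y`
      have := congrArg (fun z => s • z) h
      simp only [smul_smul, hs2, one_zsmul] at this
      rw [← this]
    -- coordinates
    obtain ⟨a, c, hvac⟩ := hspan (ev v)
    obtain ⟨a', c', hbac⟩ := hspan (ev b)
    have hsε : s * ε = 1 ∨ s * ε = -1 := by
      rcases hs with rfl | rfl <;> rcases hε with rfl | rfl <;> norm_num
    rcases hsε with h1 | h1
    · -- `Θ`-eigenvalue `1`: both `ev v`, `ev b` are multiples of `xp`
      have hv' : ev v = a • xp :=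
        (eq_smul_of_eigen Θ h2 hxp hxm hvac).1 (by rw [hΘev v hv hτv, h1, one_zsmul])
      have hb' : ev b = a' • xp :=
        (eq_smul_of_eigen Θ h2 hxp hxm hbac).1 (by rw [hΘev b hb hτb, h1, one_zsmul])
      have hane : a • xp ≠ 0 := by
        rw [← hv']; intro h0; exact hv0 (hinj v hv h0)
      obtain ⟨u, hu⟩ := isUnit_of_smul_ne_zero hm hane
      refine ⟨a' * ↑u⁻¹, hdet _ hb _ (hL _ v hv) ?_⟩
      rw [hev_smul, hv', hb', smul_smul, mul_assoc, ← hu, Units.inv_mul, mul_one]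
    · -- `Θ`-eigenvalue `-1`: both are multiples of `xm`
      have hv' : ev v = c • xm :=
        (eq_smul_of_eigen Θ h2 hxp hxm hvac).2 (by rw [hΘev v hv hτv, h1, neg_one_zsmul])
      have hb' : ev b = c' • xm :=
        (eq_smul_of_eigen Θ h2 hxp hxm hbac).2 (by rw [hΘev b hb hτb, h1, neg_one_zsmul])
      have hcne : c • xm ≠ 0 := by
        rw [← hv']; intro h0; exact hv0 (hinj v hv h0)
      obtain ⟨u, hu⟩ := isUnit_of_smul_ne_zero hm hcne
      refine ⟨c' * ↑u⁻¹, hdet _ hb _ (hL _ v hv) ?_⟩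
      rw [hev_smul, hv', hb', smul_smul, mul_assoc, ← hu, Units.inv_mul, mul_one]

omit [IsLocalRing R] in
/-- **Both eigenlines are non-zero**: under the hypotheses of `eigen_decomposition_and_line_of_eval` (only the
surjectivity of `ev` on `L`, its injectivity, the intertwining and the H.5(a)-shaped pair are used), for each sign
`ε = ±1` there is a NON-ZERO `ε`-eigenvector of `τ` in `L` (the lift of `xp` or of `xm`).
[cite: Howard2004HeegnerKolyvagin, Lemma 1.5.3 proof (arXiv:1202.6340 p. 10 L12–16) with H.5(a) (p. 7 L93–95: both eigenspaces one-dimensional, in particular non-zero)] -/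
theorem exists_eigenvector_ne_zero_of_eval (L : AddSubgroup V) (τ : V →+ V) (hτL : ∀ x ∈ L, τ x ∈ L)
    (ev : V →+ N) (hinj : ∀ x ∈ L, ev x = 0 → x = 0) (hsurj : ∀ t : N, ∃ x ∈ L, ev x = t)
    (Θ : N →ₗ[R] N) {s : ℤ} (hs : s = 1 ∨ s = -1) (hτev : ∀ x ∈ L, ev (τ x) = s • Θ (ev x))
    (hΘ : ∃ xp : N, xp ≠ 0 ∧ Θ xp = xp ∧ ∃ xm : N, xm ≠ 0 ∧ Θ xm = -xm ∧ ∀ x : N, ∃ a b : R, x = a • xp + b • xm)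
    {ε : ℤ} (hε : ε = 1 ∨ ε = -1) :
    ∃ v ∈ L, v ≠ 0 ∧ τ v = ε • v := by
  obtain ⟨xp, hxp0, hxp, xm, hxm0, hxm, -⟩ := hΘ
  have hdet : ∀ x ∈ L, ∀ y ∈ L, ev x = ev y → x = y := fun x hx y hy h =>
    sub_eq_zero.mp (hinj _ (L.sub_mem hx hy) (by rw [map_sub, h, sub_self]))
  have hs2 : s * s = 1 := by rcases hs with rfl | rfl <;> norm_num
  -- a `Θ`-eigenvector `t ≠ 0` with eigenvalue `s η` lifts to a non-zero `τ`-eigenvector with eigenvalue `η`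
  have hlift : ∀ (η : ℤ) (t : N), t ≠ 0 → Θ t = (s * η) • t → ∃ x ∈ L, x ≠ 0 ∧ τ x = η • x := by
    intro η t ht0 ht
    obtain ⟨x, hxL, hx⟩ := hsurj t
    refine ⟨x, hxL, fun h0 => ht0 (by rw [← hx, h0, map_zero]), hdet _ (hτL x hxL) _ (L.zsmul_mem hxL η) ?_⟩
    rw [hτev x hxL, hx, ht, map_zsmul, hx, smul_smul, ← mul_assoc, hs2, one_mul]
  -- the four sign cases: lift `xp` or `xm`
  rcases hs with rfl | rfl <;> rcases hε with rfl | rfl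
  · exact hlift 1 xp hxp0 (by rw [one_mul, one_zsmul, hxp])
  · exact hlift (-1) xm hxm0 (by rw [one_mul, neg_one_zsmul, hxm])
  · exact hlift 1 xm hxm0 (by rw [mul_one, neg_one_zsmul, hxm])
  · exact hlift (-1) xp hxp0 (by rw [neg_mul_neg, one_mul, one_zsmul, hxp])

end EigenlineTransport

end Literature.Algebra.Module
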